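import Mathlib
import Summits.Ventures.PercRepro2.Defs
import Summits.Ventures.PercRepro2.Graph
import Summits.Ventures.PercRepro2.OneColourSwitch
import Summits.Ventures.PercRepro2.RegionHubSign
import Summits.Ventures.PercRepro2.SideSwitch
import Summits.Ventures.PercRepro2.SideSwitchFibre
import Summits.Ventures.PercRepro2.SideSwitchClosed
import Summits.Ventures.PercRepro2.SideSwitchComps
import Summits.Ventures.PercRepro2.M9NoPocketDefs
import Summits.Ventures.PercRepro2.M9NoPocketWorld
import Summits.Ventures.PercRepro2.M9NoPocketWorldD
import Summits.Ventures.PercRepro2.M9NoPocketFibre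
import Summits.Ventures.PercRepro2.M9GeneralDSplit
import Summits.Ventures.PercRepro2.M9GeneralDHD
import Summits.Ventures.PercRepro2.M9PocketUnitFibre
import Summits.Ventures.PercRepro2.M9PocketUnitFibreSum
import Summits.Ventures.PercRepro2.M9PocketUnitKonly
import Summits.Ventures.PercRepro2.M9PocketHDTheorem
import Summits.Ventures.PercRepro2.M9PocketProdPoint
import Summits.Ventures.PercRepro2.M9PocketProdWorlds
import Summits.Ventures.PercRepro2.M9PocketProdMono
import Summits.Ventures.PercRepro2.M9PocketProdSum
import Summits.Ventures.PercRepro2.M9PocketProdSkel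
import Summits.Ventures.PercRepro2.M9PocketProdFam
import Summits.Ventures.PercRepro2.M9PocketProdPartition
import Summits.Ventures.PercRepro2.M9PocketProdWsideFam
import Summits.Ventures.PercRepro2.M9PocketProdAssembly
import Summits.Ventures.PercRepro2.M9PocketUnitFibreSumT
import Summits.Ventures.PercRepro2.M9PocketProdPointT
import Summits.Ventures.PercRepro2.M9PocketProdWorldsT
import Summits.Ventures.PercRepro2.M9PocketProdMonoT
import Summits.Ventures.PercRepro2.M9PocketProdHDT
import Summits.Ventures.PercRepro2.M9PocketProdLinkT
import Summits.Ventures.PercRepro2.M9PocketProdSumT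
import Summits.Ventures.PercRepro2.M9PocketProdSkelT
import Summits.Ventures.PercRepro2.M9PocketProdPartitionT
import Summits.Ventures.PercRepro2.M9PocketProdWsideFamT

/-!
# [`T`-edge chain] The single-`d` sign sum with free non-linking blocks and `T`-edges
(blind cell PercRepro2, p3 g40, 2026-08-29; `proofs/P3-POCKETRK.md` §10‴: the `T`-edge chain,
assembly)

`M9PocketProdAssembly` without the hypothesis «no `d r`, `d s` edge»: the `K`-half of the
hub–dead-end sum is partitioned by the skeleton map (`M9PocketProdPartitionT`), the fibre over a
skeleton `ρ` is the product fibre of `ρ` (`prod_index_eq_T`, `index_prod_iff_T`,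
`wside_block_mem_fam_T`), on which the sum is non-positive (`sum_prod_fibre_HD_nonpos_T`) — every
`T`-edge is `Y` at a `K`-only point (`d ∉ M₂`), which is all the chain ever used.  Hence

* `sum_skel_fibre_nonpos_T` — the `HD`, `d ∈ K₂` sum over the points with skeleton `ρ` is `≤ 0`;
* `hdK_nonpos_of_noLinking_T` — the `K`-half of the hub–dead-end sum is `≤ 0`;
* **`dSignSum_nonpos_of_noLinking_T`** — `dSignSum ≤ 0` for every graph with no edge inside
  `{r, s}` in which no free block of `G − d` (a component of the sided set of a `K`-only
  skeleton carrying no `d`-edge) is adjacent to both `r` and `s`; `T`-edges arbitrary;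
* **`dSignSum_nonpos_of_sepN_T`** — the same when the neighbourhood of `d` separates `r` from
  `s` in `G − d`: no `r`–`s` path of `G − d` whose vertices are non-neighbours of `d` or `r`, `s`
  (`noLinking_of_sepN_T`; with `T`-edges `r`, `s` may themselves be neighbours of `d`).

Contains `dSignSum_nonpos_of_noLinking` / `dSignSum_nonpos_of_sepN` (the `T`-free case).  Own
work; std axioms.
-/

namespace Summit.Ventures.PercRepro2

namespace NoPocket

open Finset Classical OneColourSwitch SideSwitch

variable {V : Type*} {E : Type*} {ends : E → Sym2 V} {p q r s d : V}

section Skel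

variable [Fintype V] [DecidableEq V] [Fintype E] [DecidableEq E]

/-- **The `HD`, `d ∈ K₂` sum over the points with skeleton `ρ` is non-positive** when no free
component of the sided set of `ρ` is adjacent to both `r` and `s`: the fibre is the product
fibre of `ρ` indexed by its switchable blocks and free edges. -/
theorem sum_skel_fibre_nonpos_T (hdr : d ≠ r) (hds : d ≠ s)
    (hrs : within ends ({r, s} : Set V) = ∅)
    (hp : p ≠ d) (hq : q ≠ d) {ρ : Config E}
    (hsep : sep2 ends p q r s ρ) (hD : DOne ends r s d ρ) (hK : d ∈ K2 ends r s ρ)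
    (hM : d ∉ M2 ends r s ρ)
    (hB : ∀ x ∈ M2 (endsD ends d) r s ρ, x = r ∨ x = s)
    (hρR : ∀ e ∉ touches ends (cluster ends ρ d ∪ K2 (endsD ends d) r s ρ ∪
      M2 (endsD ends d) r s ρ), ρ e = false)
    (hnl : ∀ C ∈ comps (endsD ends d) r s ρ, (∀ e y, y ∈ C → ends e ≠ s(d, y)) →
      (∀ e y, y ∈ C → ends e ≠ s(r, y)) ∨ (∀ e y, y ∈ C → ends e ≠ s(s, y))) :
    ∑ ω ∈ (univ.filter (fun ω : Config E => HD ends p q r s d ω ∧ d ∈ K2 ends r s ω)).filter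
        (fun ω => (fun e => if e ∈ touches ends
          (cluster ends (flipTouch (endsD ends d)
              {x : V | x ∈ M2 (endsD ends d) r s ω ∧ x ≠ r ∧ x ≠ s} ω) d ∪
            K2 (endsD ends d) r s (flipTouch (endsD ends d)
              {x : V | x ∈ M2 (endsD ends d) r s ω ∧ x ≠ r ∧ x ≠ s} ω) ∪
            M2 (endsD ends d) r s (flipTouch (endsD ends d)
              {x : V | x ∈ M2 (endsD ends d) r s ω ∧ x ≠ r ∧ x ≠ s} ω)) then
          flipTouch (endsD ends d) {x : V | x ∈ M2 (endsD ends d) r s ω ∧ x ≠ r ∧ x ≠ s} ω e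
          else false) = ρ),
      sigma ends ω p q * sigma ends ω r s ≤ 0 := by
  have hR := mem_R_iff (ends := ends) (r := r) (s := s) (d := d) (ρ := ρ)
  have h𝔉K := fam_subset_K2 (ends := ends) (d := d) hB
  have key := sum_prod_fibre_HD_nonpos_T (p := p) (q := q) hdr hds hrs hM hsep hD hK hB hR h𝔉K
    fam_notMem_r fam_notMem_s fam_closedIn fam_free fam_pocket fam_disjoint (fam_nl_of hnl)
  refine sum_fibre_nonpos_of_bij key (fun ω => univ.filter (fun i =>
    (∀ c, i = Sum.inl c →
      (↑c.1 : Set V) ⊆ {x : V | x ∈ M2 (endsD ends d) r s ω ∧ x ≠ r ∧ x ≠ s}) ∧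
    ∀ e, i = Sum.inr e → ω e.1 = true)) mem_univ_index ?_ ?_ ?_ ?_
  · intro ω hω
    rw [Finset.mem_filter, Finset.mem_filter] at hω
    obtain ⟨⟨_, hHD⟩, hρω⟩ := hω
    obtain ⟨hsepω, hDω, hKω, hMω, _⟩ := HD_konly_iff.1 hHD
    exact prod_index_eq_T hdr hds hsepω hDω hKω hMω hp hq hρω.symm hR h𝔉K
      (wside_block_mem_fam_T hdr hds hsepω hDω hKω hMω hρω.symm) _
      (fun i => Finset.mem_filter.trans (and_iff_right (Finset.mem_univ i)))
  · intro S
    ext i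
    exact (Finset.mem_filter.trans (and_iff_right (Finset.mem_univ i))).trans
      (index_prod_iff_T hdr hds hrs hM hsep hB hR h𝔉K fam_notMem_r fam_notMem_s fam_closedIn
        fam_disjoint fam_nonempty S i).symm
  · intro ω hω
    rw [Finset.mem_filter, Finset.mem_filter] at hω
    exact (HD_konly_iff.1 hω.1.2).2.2.2.2
  · intro S hS
    rw [Finset.mem_filter, Finset.mem_filter]
    refine ⟨⟨Finset.mem_univ _, HD_konly_iff.2 ⟨sep2_prod_T hdr hds hrs hM hsep hD hK hB hR h𝔉K
      fam_notMem_r fam_notMem_s fam_closedIn fam_free fam_pocket S hp hq,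
      DOne_prod_T hdr hds hrs hM hsep hD hB hR h𝔉K fam_notMem_r fam_notMem_s fam_closedIn
        fam_free fam_pocket S,
      d_mem_K2_prod_T hdr hds hrs hM hsep hK hB hR h𝔉K fam_notMem_r fam_notMem_s fam_closedIn
        fam_free S,
      d_notMem_M2_prod_T hdr hds hrs hM hsep hB hR h𝔉K fam_notMem_r fam_notMem_s fam_closedIn
        fam_free S, hS⟩⟩, ?_⟩
    exact skel_prod_eq_T hdr hds hrs hM hsep hB hρR hR h𝔉K fam_notMem_r fam_notMem_s fam_closedIn S

/-- **The `K`-half of the hub–dead-end sum is non-positive** when no free block of `G − d` is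
adjacent to both `r` and `s`: partition by the skeleton. -/
theorem hdK_nonpos_of_noLinking_T (hdr : d ≠ r) (hds : d ≠ s)
    (hrs : within ends ({r, s} : Set V) = ∅)
    (hp : p ≠ d) (hq : q ≠ d)
    (hnl : ∀ ρ : Config E, ∀ C ∈ comps (endsD ends d) r s ρ,
      (∀ e y, y ∈ C → ends e ≠ s(d, y)) →
      (∀ e y, y ∈ C → ends e ≠ s(r, y)) ∨ (∀ e y, y ∈ C → ends e ≠ s(s, y))) :
    (∑ ω : Config E, if HD ends p q r s d ω ∧ d ∈ K2 ends r s ω then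
      sigma ends ω p q * sigma ends ω r s else 0) ≤ 0 := by
  rw [← Finset.sum_filter]
  have hmaps : ∀ ω ∈ univ.filter (fun ω : Config E => HD ends p q r s d ω ∧ d ∈ K2 ends r s ω),
      (fun e => if e ∈ touches ends
          (cluster ends (flipTouch (endsD ends d)
              {x : V | x ∈ M2 (endsD ends d) r s ω ∧ x ≠ r ∧ x ≠ s} ω) d ∪
            K2 (endsD ends d) r s (flipTouch (endsD ends d)
              {x : V | x ∈ M2 (endsD ends d) r s ω ∧ x ≠ r ∧ x ≠ s} ω) ∪
            M2 (endsD ends d) r s (flipTouch (endsD ends d)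
              {x : V | x ∈ M2 (endsD ends d) r s ω ∧ x ≠ r ∧ x ≠ s} ω)) then
          flipTouch (endsD ends d) {x : V | x ∈ M2 (endsD ends d) r s ω ∧ x ≠ r ∧ x ≠ s} ω e
          else false) ∈ univ.filter (fun ρ : Config E =>
        sep2 ends p q r s ρ ∧ DOne ends r s d ρ ∧ d ∈ K2 ends r s ρ ∧ d ∉ M2 ends r s ρ ∧
          (∀ x ∈ M2 (endsD ends d) r s ρ, x = r ∨ x = s) ∧
          ∀ e ∉ touches ends (cluster ends ρ d ∪ K2 (endsD ends d) r s ρ ∪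
            M2 (endsD ends d) r s ρ), ρ e = false) := by
    intro ω hω
    rw [Finset.mem_filter] at hω
    obtain ⟨hsep, hD, hK, hM, _⟩ := HD_konly_iff.1 hω.2
    rw [Finset.mem_filter]
    refine ⟨Finset.mem_univ _, ?_⟩
    obtain ⟨h1, h2, h3, h4, h5, -, h7⟩ := skel_legal_T hdr hds hrs hsep hD hK hM hp hq
    exact ⟨h1, h2, h3, h4, h5, h7⟩
  rw [← Finset.sum_fiberwise_of_maps_to hmaps]
  refine Finset.sum_nonpos fun ρ hρ => ?_
  rw [Finset.mem_filter] at hρ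
  obtain ⟨_, hsep, hD, hK, hM, hB, hρR⟩ := hρ
  exact sum_skel_fibre_nonpos_T hdr hds hrs hp hq hsep hD hK hM hB hρR (hnl ρ)

/-- **The single-`d` sign sum is non-positive for graphs without a linking free block**: no
edge inside `{r, s}` (`T`-edges `d r`, `d s` allowed), and no free block of `G − d` (a component
of the sided set of a `K`-only skeleton carrying no `d`-edge) is adjacent to both `r` and `s`. -/
theorem dSignSum_nonpos_of_noLinking_T (hdr : d ≠ r) (hds : d ≠ s)
    (hrs : within ends ({r, s} : Set V) = ∅)
    (hnl : ∀ ρ : Config E, ∀ C ∈ comps (endsD ends d) r s ρ,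
      (∀ e y, y ∈ C → ends e ≠ s(d, y)) →
      (∀ e y, y ∈ C → ends e ≠ s(r, y)) ∨ (∀ e y, y ∈ C → ends e ≠ s(s, y))) :
    dSignSum ends p q r s d ≤ 0 := by
  refine dSignSum_nonpos_of_hdSum_nonpos hdr.symm hds.symm ?_
  rw [hdSum_eq_two_mul_hdK]
  by_cases h : p = d ∨ q = d
  · rw [hdK_eq_zero_of_eq h]; norm_num
  · rw [not_or] at h
    have := hdK_nonpos_of_noLinking_T (p := p) (q := q) hdr hds hrs h.1 h.2 hnl
    omega

end Skel

section Separation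

variable [Fintype V] [DecidableEq V]

/-- **Separation gives the non-linking hypothesis**: if the neighbourhood of `d` separates `r`
from `s` in `G − d` (no `r`–`s` path of `G − d` whose vertices are non-neighbours of `d` or
`r`, `s` themselves — with `T`-edges `r`, `s` may be neighbours of `d`), then no free component
of a sided set is adjacent to both `r` and `s`. -/
lemma noLinking_of_sepN_T (hdr : d ≠ r) (hds : d ≠ s)
    (hsepN : ¬ Conn (endsD ends d) (chi (endsD ends d)
      ({x : V | ∀ e, ends e ≠ s(d, x)} ∪ {r, s})) r s) :
    ∀ ρ : Config E, ∀ C ∈ comps (endsD ends d) r s ρ, (∀ e y, y ∈ C → ends e ≠ s(d, y)) →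
      (∀ e y, y ∈ C → ends e ≠ s(r, y)) ∨ (∀ e y, y ∈ C → ends e ≠ s(s, y)) := by
  intro ρ C hC hfree
  by_contra hboth
  rw [not_or] at hboth
  obtain ⟨h₁, h₂⟩ := hboth
  simp only [not_forall, not_not] at h₁ h₂
  obtain ⟨e₁, y₁, hy₁, he₁⟩ := h₁
  obtain ⟨e₂, y₂, hy₂, he₂⟩ := h₂
  apply hsepN
  -- the vertices of `C` are non-neighbours of `d` different from `d`
  have hCN : (↑C : Set V) ⊆ {x : V | ∀ e, ends e ≠ s(d, x)} ∪ {r, s} :=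
    fun y hy => Or.inl (fun e => hfree e y (Finset.mem_coe.1 hy))
  have hCd : ∀ y ∈ C, y ≠ d := by
    intro y hy hyd
    have := mem_A0.1 (subset_A0_of_mem_comps hC hy)
    rw [hyd] at this
    rcases this.1 with h | h
    · exact not_mem_K2_endsD hdr hds ρ h
    · exact not_mem_M2_endsD hdr hds ρ h
  have hrN : r ∈ {x : V | ∀ e, ends e ≠ s(d, x)} ∪ {r, s} := Or.inr (Set.mem_insert r {s})
  have hsN : s ∈ {x : V | ∀ e, ends e ≠ s(d, x)} ∪ {r, s} :=
    Or.inr (Set.mem_insert_of_mem r rfl)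
  -- `r ~ y₁` and `y₂ ~ s` through the attaching edges
  have hr1 : Conn (endsD ends d) (chi (endsD ends d)
      ({x : V | ∀ e, ends e ≠ s(d, x)} ∪ {r, s})) r y₁ := by
    have hde : d ∉ ends e₁ := notMem_of_ends_ne he₁ hdr.symm (hCd y₁ hy₁)
    refine conn_of_openAdj ⟨e₁, chi_eq_true_iff.2 ⟨r, hrN, y₁, hCN (Finset.mem_coe.2 hy₁), ?_⟩, ?_⟩
    · rw [endsD_of_notMem hde, he₁]
    · rw [endsD_of_notMem hde, he₁]
  have hs2 : Conn (endsD ends d) (chi (endsD ends d)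
      ({x : V | ∀ e, ends e ≠ s(d, x)} ∪ {r, s})) y₂ s := by
    have hde : d ∉ ends e₂ := notMem_of_ends_ne he₂ hds.symm (hCd y₂ hy₂)
    refine conn_of_openAdj ⟨e₂, chi_eq_true_iff.2 ⟨s, hsN, y₂, hCN (Finset.mem_coe.2 hy₂), ?_⟩, ?_⟩
    · rw [endsD_of_notMem hde, he₂, Sym2.eq_swap]
    · rw [endsD_of_notMem hde, he₂, Sym2.eq_swap]
  -- `y₁ ~ y₂` inside the component, transferred to the non-neighbours
  have h12 : Conn (endsD ends d) (chi (endsD ends d)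
      ({x : V | ∀ e, ends e ≠ s(d, x)} ∪ {r, s})) y₁ y₂ := by
    have hcomp : Conn (endsD ends d) (chi (endsD ends d) (↑(A0 (endsD ends d) r s ρ) : Set V))
        y₁ y₂ := by
      have := eq_compIn_of_mem_comps hC hy₁
      rw [this] at hy₂
      exact mem_compIn.1 hy₂
    refine conn_chi_of_conn_chi_closed hCN ?_ (Finset.mem_coe.2 hy₁) hcomp
    intro a ha b hab
    obtain ⟨_, e, he, hends⟩ := openGraph_adj.1 hab
    obtain ⟨u, hu, v, hv, huv⟩ := chi_eq_true_iff.1 he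
    have hbA : b ∈ A0 (endsD ends d) r s ρ := by
      rw [hends, Sym2.eq_iff] at huv
      rcases huv with ⟨_, h2⟩ | ⟨_, h2⟩
      · rw [h2]; exact Finset.mem_coe.1 hv
      · rw [h2]; exact Finset.mem_coe.1 hu
    exact closedIn_of_mem_comps hC e a b hends ha (by rw [sided_eq_coe_A0]; exact hbA)
  exact conn_trans hr1 (conn_trans h12 hs2)

/-- **The single-`d` sign sum is non-positive when the neighbourhood of `d` separates `r`
from `s` in `G − d`, `T`-edges allowed** (the headline class of the pocket theorem): no edge
inside `{r, s}`, and no `r`–`s` path of `G − d` whose vertices are non-neighbours of `d` or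
`r`, `s` themselves; `p`, `q` and the edges `d r`, `d s` arbitrary (for `p = d` or `q = d` the
`K`-half is empty). -/
theorem dSignSum_nonpos_of_sepN_T [Fintype E] [DecidableEq E] (hdr : d ≠ r) (hds : d ≠ s)
    (hrs : within ends ({r, s} : Set V) = ∅)
    (hsepN : ¬ Conn (endsD ends d) (chi (endsD ends d)
      ({x : V | ∀ e, ends e ≠ s(d, x)} ∪ {r, s})) r s) :
    dSignSum ends p q r s d ≤ 0 :=
  dSignSum_nonpos_of_noLinking_T hdr hds hrs (noLinking_of_sepN_T hdr hds hsepN)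

end Separation

end NoPocket

end Summit.Ventures.PercRepro2
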